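import Summits.CriticalPhenomena.PercolationContinuityZ3.Theorems.PercNearOneGluingNoHeavyPcintMemUniform
import HarnessLib

/-!
# CriticalPhenomena/PercolationContinuityZ3 — Theorems/PercNearOneGluingNoHeavyPcintMemUniformGen.lean: the transfer principle in any base dimension — one dimension-`(k+1)` row list whose rows live on the first `k` axes simulates `mstep τ` on `ℤ^d` for every `d ≥ k + 1`

Lane prim-pcint, STRUCTURE rule (prim-pcint-2 GEN 18).  …PcintMemUniform is the case `k = 3` (memory `6`: states span ≤ 3 axes, base
dimension `4`).  Memory `8` states span ≤ 4 axes (289 classes, all present on `ℤ⁴` already, none needing a fifth axis — P19a), so its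
uniform certificate lives in base dimension `5` with axis `4` fresh; memory `τ` in base dimension `τ/2 + 1`.  This file repeats the
construction with the base dimension as a parameter:

* `uistepK k L d` — the index automaton of `L : List (SCertRow (k+1))` read in dimension `d`: letters on axes `< k+1` act as recorded,
  letters on axes `≥ k+1` act like axis `k` (`Fin.last k`);
* `UStructK`, `USuppK` (every row vanishes on axis `k`; decidable), `ustructK_of_scertOK`;
* `uistepK_some` / `uistepK_none`, **`cnt_mstep_eq_cnt_uistepK`** and **`cntP_mstep_eq_cntP_uistepK`** (`d ≥ k + 1`).
Proofs are those of …PcintMemUniform verbatim with `4 ↦ k + 1`, `3 ↦ Fin.last k`.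

HONEST FRAMING: bookkeeping.  No `sorry`; standard axioms.  Written by prim-pcint-2 gen 18 (prover-prim-pcint-2-g18-0), 2026-08-26.
-/

noncomputable section

open Literature.Probability.Percolation Literature.Probability.LatticeModels

namespace Summit.CriticalPhenomena.PercolationContinuityZ3.Theorems.Pcint

/-! ### The uniform index automaton of a dimension-4 row list -/

section UniformK

variable {k d : ℕ}

/-- The index automaton of a dimension-`(k+1)` row list read in dimension `d`: letters on axes `< k+1` act as recorded, letters on
axes `≥ k+1` act like the corresponding letter on axis `k`. [folklore] -/
def uistepK (k : ℕ) (L : List (SCertRow (k + 1))) (d : ℕ) (i : ℕ) (a : Fin d × Bool) : Option ℕ :=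
  if h : (a.1 : ℕ) < k + 1 then sistep L i (⟨a.1, h⟩, a.2) else sistep L i (Fin.last k, a.2)

/-- Structural validity of a row list (the structural conjuncts of `SCertOK`): row `0` is `∅`, every recorded successor is the
true `mstep` successor up to the recorded symmetry, indices are in range. [folklore] -/
def UStructK (τ : ℕ) (L : List (SCertRow (k + 1))) : Prop :=
  0 < L.length ∧ sstOf L 0 = ∅ ∧
    ∀ i < L.length, ∀ a : Fin (k + 1) × Bool,
      mstep τ (sstOf L i) a = (ssucc L i a).map (fun p => smulState p.2 (sstOf L p.1)) ∧
        ∀ p ∈ ssucc L i a, p.1 < L.length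

/-- Every valid certificate modulo symmetry is structurally valid. [folklore] -/
theorem ustructK_of_scertOK {τ num den m : ℕ} {L : List (SCertRow (k + 1))} (h : SCertOK τ num den m L) : UStructK τ L :=
  ⟨h.1, h.2.1, fun i hi => (h.2.2 i hi).1⟩

/-- Support condition: every row state vanishes on axis `3` (so axis `3` is fresh for every row). Decidable. [folklore] -/
def USuppK (L : List (SCertRow (k + 1))) : Prop := ∀ i < L.length, ∀ q ∈ sstOf L i, q.1 (Fin.last k) = 0

/-- `USupp` is decidable. [folklore] -/
instance (L : List (SCertRow (k + 1))) : Decidable (USuppK L) := by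
  unfold USuppK; infer_instance

/-- A padded row state vanishes on every axis `≥ 3` of `ℤ^d`. [folklore] -/
theorem padState_row_applyK {L : List (SCertRow (k + 1))} (hS : USuppK L) {i : ℕ} (hi : i < L.length)
    {q : Site d × ℕ} (hq : q ∈ padState d (sstOf L i)) {v : Fin d} (hv : k ≤ (v : ℕ)) : q.1 v = 0 := by
  obtain ⟨r, hr, hqr⟩ := (mem_padState _ q).1 hq
  rw [hqr]
  by_cases hv4 : (v : ℕ) < k + 1
  · rw [padSite_apply_lt r hv4]
    have h3 : (⟨v, hv4⟩ : Fin (k + 1)) = Fin.last k := by ext; simp; omega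
    rw [h3]; exact hS i hi (r, q.2) hr
  · exact padSite_apply_ge r (Nat.not_lt.1 hv4)

/-- Reading a letter on an axis `≥ 4` from a padded row state = reading axis `3`, then a transposition. [folklore] -/
theorem mstep_padState_highK (τ : ℕ) (hd : k + 1 ≤ d) {L : List (SCertRow (k + 1))} (hS : USuppK L) {i : ℕ} (hi : i < L.length)
    (a : Fin d × Bool) (ha : ¬ (a.1 : ℕ) < k + 1) :
    mstep τ (padState d (sstOf L i)) a =
      ((mstep τ (sstOf L i) (Fin.last k, a.2)).map (padState d)).map
        (smulState (swapPerm (Fin.castLE hd (Fin.last k)) a.1)) := by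
  rcases a with ⟨v, b⟩
  have hv3 : k ≤ (v : ℕ) := by simp only [not_lt] at ha; omega
  have hfresh : ∀ q ∈ padState d (sstOf L i), q.1 (Fin.castLE hd (Fin.last k)) = 0 ∧ q.1 v = 0 := fun q hq =>
    ⟨padState_row_applyK hS hi hq (by simp), padState_row_applyK hS hi hq hv3⟩
  rw [mstep_fresh τ (Fin.castLE hd (Fin.last k)) v b hfresh]
  have : ((Fin.castLE hd (Fin.last k), b) : Fin d × Bool) = padLetter hd (Fin.last k, b) := rfl
  rw [this, mstep_pad]

/-- Reading a letter on an axis `< k+1` from a padded row state = padding the base successor. [folklore] -/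
theorem mstep_padState_lowK (τ : ℕ) (hd : k + 1 ≤ d) (L : List (SCertRow (k + 1))) (i : ℕ) (a : Fin d × Bool)
    (ha : (a.1 : ℕ) < k + 1) :
    mstep τ (padState d (sstOf L i)) a = (mstep τ (sstOf L i) (⟨a.1, ha⟩, a.2)).map (padState d) := by
  conv_lhs => rw [← padLetter_mk hd a ha]
  rw [mstep_pad]

/-- Successor data of the uniform index automaton: an accepted letter of `ℤ^d` leads to a row `j` in range, and the true
successor of the padded row state is the padded row-`j` state up to a symmetry of `ℤ⁴` and a symmetry of `ℤ^d`. [folklore] -/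
theorem uistepK_some {τ : ℕ} {L : List (SCertRow (k + 1))} (hd : k + 1 ≤ d) (hU : UStructK τ L) (hS : USuppK L) {i : ℕ}
    (hi : i < L.length) {a : Fin d × Bool} {j : ℕ} (hij : uistepK k L d i a = some j) :
    j < L.length ∧ ∃ g : SPerm (k + 1), ∃ G : SPerm d,
      mstep τ (padState d (sstOf L i)) a = some (smulState G (padState d (smulState g (sstOf L j)))) := by
  obtain ⟨-, -, hrows⟩ := hU
  unfold uistepK at hij
  by_cases ha : (a.1 : ℕ) < k + 1
  · rw [dif_pos ha] at hij
    unfold sistep at hij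
    cases hs : ssucc L i (⟨a.1, ha⟩, a.2) with
    | none => rw [hs] at hij; exact absurd hij (by simp)
    | some p =>
      rw [hs, Option.map_some] at hij
      simp only [Option.some.injEq] at hij
      have hj : p.1 < L.length := (hrows i hi (⟨a.1, ha⟩, a.2)).2 p (by rw [hs]; simp)
      refine ⟨hij ▸ hj, p.2, ⟨Equiv.refl _, fun _ => true⟩, ?_⟩
      have he := (hrows i hi (⟨a.1, ha⟩, a.2)).1
      rw [mstep_padState_lowK τ hd L i a ha, he, hs, Option.map_some, Option.map_some, ← hij]
      congr 1
      ext ⟨x, m⟩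
      rw [mem_smulState]
      constructor
      · intro hx; exact ⟨x, hx, by ext i; simp [smulSite]⟩
      · rintro ⟨r, hr, hxr⟩
        have hx : x = smulSite ((Equiv.refl (Fin d), fun _ => true) : SPerm d) r := hxr
        have : x = r := by rw [hx]; ext i; simp [smulSite]
        rw [this]; exact hr
  · rw [dif_neg ha] at hij
    unfold sistep at hij
    cases hs : ssucc L i (Fin.last k, a.2) with
    | none => rw [hs] at hij; exact absurd hij (by simp)
    | some p =>
      rw [hs, Option.map_some] at hij
      simp only [Option.some.injEq] at hij
      have hj : p.1 < L.length := (hrows i hi (Fin.last k, a.2)).2 p (by rw [hs]; simp)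
      refine ⟨hij ▸ hj, p.2, swapPerm (Fin.castLE hd (Fin.last k)) a.1, ?_⟩
      have he := (hrows i hi (Fin.last k, a.2)).1
      rw [mstep_padState_highK τ hd hS hi a ha, he, hs, Option.map_some, Option.map_some, Option.map_some, ← hij]

/-- A rejected letter of the uniform index automaton is rejected by `mstep` from the padded row state. [folklore] -/
theorem uistepK_none {τ : ℕ} {L : List (SCertRow (k + 1))} (hd : k + 1 ≤ d) (hU : UStructK τ L) (hS : USuppK L) {i : ℕ}
    (hi : i < L.length) {a : Fin d × Bool} (hia : uistepK k L d i a = none) :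
    mstep τ (padState d (sstOf L i)) a = none := by
  obtain ⟨-, -, hrows⟩ := hU
  unfold uistepK at hia
  by_cases ha : (a.1 : ℕ) < k + 1
  · rw [dif_pos ha] at hia
    unfold sistep at hia
    have he := (hrows i hi (⟨a.1, ha⟩, a.2)).1
    cases hs : ssucc L i (⟨a.1, ha⟩, a.2) with
    | none =>
      rw [hs, Option.map_none] at he
      rw [mstep_padState_lowK τ hd L i a ha, he]; rfl
    | some p => rw [hs] at hia; exact absurd hia (by simp)
  · rw [dif_neg ha] at hia
    unfold sistep at hia
    have he := (hrows i hi (Fin.last k, a.2)).1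
    cases hs : ssucc L i (Fin.last k, a.2) with
    | none =>
      rw [hs, Option.map_none] at he
      rw [mstep_padState_highK τ hd hS hi a ha, he]; rfl
    | some p => rw [hs] at hia; exact absurd hia (by simp)

/-- **Uniformity in the dimension**: for `d ≥ 4` the memory-`τ` counts of `ℤ^d` are the accepted-word counts of the uniform
index automaton of any structurally valid dimension-4 row list whose rows vanish on axis `3`.
[cite: PonitzTittmann2000, §3 (symmetry-reduced automata)] -/
theorem cnt_mstep_eq_cnt_uistepK {τ : ℕ} {L : List (SCertRow (k + 1))} (hd : k + 1 ≤ d) (hU : UStructK τ L) (hS : USuppK L)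
    (n : ℕ) : cnt (mstep τ) (∅ : MState d) n = cnt (uistepK k L d) 0 n := by
  have h0 := hU.1
  have hst0 := hU.2.1
  set R : Set ℕ := {i | i < L.length} with hRdef
  have hR : ∀ i ∈ R, ∀ a j, uistepK k L d i a = some j → j ∈ R := fun i hi a j hij =>
    (uistepK_some hd hU hS hi hij).1
  have hnone : ∀ i ∈ R, ∀ a, uistepK k L d i a = none → mstep τ (padState d (sstOf L i)) a = none :=
    fun i hi a hia => uistepK_none hd hU hS hi hia
  have hsome : ∀ i ∈ R, ∀ a j, uistepK k L d i a = some j →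
      ∃ T, mstep τ (padState d (sstOf L i)) a = some T ∧
        ∀ n, cnt (mstep τ) T n = cnt (mstep τ) (padState d (sstOf L j)) n := by
    intro i hi a j hij
    obtain ⟨-, g, G, hG⟩ := uistepK_some hd hU hS hi hij
    refine ⟨_, hG, fun n => ?_⟩
    rw [cnt_smulState, ← smulState_padPerm hd, cnt_smulState]
  have h1 := cnt_eq_of_simulation_upto (mstep τ) (uistepK k L d) (fun i => padState d (sstOf L i)) R hR hnone hsome n 0 h0
  simpa [hst0] using h1

/-! ### The same with a final-state predicate (exact closing counts) -/

/-- **Uniformity in the dimension, with the age predicate**: for `d ≥ 4` the number of memory-`τ` words of `ℤ^d` whose final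
dangerous set has an entry of age `j` is the corresponding count of the uniform index automaton (predicate read on the row
states). [cite: PonitzTittmann2000, §3] -/
theorem cntP_mstep_eq_cntP_uistepK {τ : ℕ} {L : List (SCertRow (k + 1))} (hd : k + 1 ≤ d) (hU : UStructK τ L) (hS : USuppK L)
    (j n : ℕ) :
    cntP (mstep τ) (HasAge j) (∅ : MState d) n = cntP (uistepK k L d) (fun i => HasAge j (sstOf L i)) 0 n := by
  have h0 := hU.1
  have hst0 := hU.2.1
  set R : Set ℕ := {i | i < L.length} with hRdef
  have hR : ∀ i ∈ R, ∀ a j, uistepK k L d i a = some j → j ∈ R := fun i hi a j hij =>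
    (uistepK_some hd hU hS hi hij).1
  have hnone : ∀ i ∈ R, ∀ a, uistepK k L d i a = none → mstep τ (padState d (sstOf L i)) a = none :=
    fun i hi a hia => uistepK_none hd hU hS hi hia
  have hsome : ∀ i ∈ R, ∀ a j', uistepK k L d i a = some j' →
      ∃ T, mstep τ (padState d (sstOf L i)) a = some T ∧
        ∀ n, cntP (mstep τ) (HasAge j) T n = cntP (mstep τ) (HasAge j) (padState d (sstOf L j')) n := by
    intro i hi a j' hij
    obtain ⟨-, g, G, hG⟩ := uistepK_some hd hU hS hi hij
    refine ⟨_, hG, fun n => ?_⟩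
    rw [cntP_hasAge_smulState, ← smulState_padPerm hd, cntP_hasAge_smulState]
  have hP : ∀ i ∈ R, (HasAge j (padState d (sstOf L i)) ↔ HasAge j (sstOf L i)) := fun i _ => hasAge_padState j _
  have h1 := cntP_eq_of_simulation_upto (mstep τ) (uistepK k L d) (fun i => padState d (sstOf L i)) R (HasAge j)
    (fun i => HasAge j (sstOf L i)) hP hR hnone hsome n 0 h0
  simpa [hst0] using h1

end UniformK

end Summit.CriticalPhenomena.PercolationContinuityZ3.Theorems.Pcint
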